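import Mathlib.Topology.Algebra.Order.Field
import Mathlib.Topology.ContinuousMap.Basic
import Mathlib.Algebra.QuadraticDiscriminant
import Mathlib.Analysis.SpecialFunctions.Pow.Real
import HarnessLib

/-!
# Markov operators on bounded continuous functions: constants, order bounds, Cauchy–Schwarz

Elementary consequences of the three defining properties of a Markov operator `T` acting on bounded
continuous functions of a topological space — linearity `T(c h₁ + h₂) = c T h₁ + T h₂`, positivity
`h ≥ 0 ⇒ T h ≥ 0`, and `T 𝟙 = 𝟙` (D. Bakry, I. Gentil, M. Ledoux, *Analysis and Geometry of Markov
Diffusion Operators*, Springer 2014, Def. 1.2.1 and (1.2.1)–(1.2.2), p. 10–11: "mass conservation …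
positivity preserving … Jensen's inequality … `P_t` is a contraction") — in the form in which the heat
semigroup of a complete weighted manifold is delivered by the named fact
`weightedHeatSemigroup_strongGradientBound_complete` (`WeightedHeatSemigroupComplete.lean`) and
consumed by the Bakry–Émery argument on a complete manifold (`BakryEmeryLogSobolevSemigroup.lean`):

* `markov_map_zero`, `markov_map_const`, `markov_apply_affine` — `T 0 = 0`, `T c = c`,
  `T(c h + d) = c T h + d`;
* `markov_apply_mem_Icc` — `m ≤ h ≤ m'` implies `m ≤ T h ≤ m'` (contraction / maximum principle);
* `markov_sq_apply_mul_le` — the Cauchy–Schwarz inequality `(T(φψ))² ≤ T(φ²) T(ψ²)` (positivity of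
  `T((φ − λψ)²)` for every real `λ` and the discriminant).

The three properties are carried as explicit hypotheses `hlin`, `hpos`, `hone` (no definition is
introduced). Theorems only.

## References

* [BakryGentilLedoux2014] D. Bakry, I. Gentil, M. Ledoux, *Analysis and Geometry of Markov Diffusion
  Operators*, Springer 2014, Def. 1.2.1, (1.2.1)–(1.2.2) (pp. 10–11). READ (held text).
-/

noncomputable section

open Set Filter
open scoped Topology

namespace Literature.Geometry.Riemannian

universe uM

variable {M : Type uM} [TopologicalSpace M] {T : (M → ℝ) → M → ℝ}

/-- **`T 0 = 0`** for an operator linear on bounded continuous functions. [folklore] -/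
theorem markov_map_zero
    (hlin : ∀ (h₁ h₂ : M → ℝ) (c : ℝ), Continuous h₁ → (∃ C, ∀ x, |h₁ x| ≤ C) →
      Continuous h₂ → (∃ C, ∀ x, |h₂ x| ≤ C) →
      T (fun x ↦ c * h₁ x + h₂ x) = fun x ↦ c * T h₁ x + T h₂ x) :
    T (fun _ ↦ (0 : ℝ)) = fun _ ↦ 0 := by
  have h := hlin (fun _ ↦ (0 : ℝ)) (fun _ ↦ (0 : ℝ)) 1 continuous_const ⟨0, fun _ ↦ by simp⟩
    continuous_const ⟨0, fun _ ↦ by simp⟩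
  have hfun : (fun _ : M ↦ (1 : ℝ) * 0 + 0) = fun _ ↦ (0 : ℝ) := funext fun _ ↦ by ring
  rw [hfun] at h
  funext x
  have hx : T (fun _ ↦ (0 : ℝ)) x = 1 * T (fun _ ↦ (0 : ℝ)) x + T (fun _ ↦ (0 : ℝ)) x :=
    congrFun h x
  linarith

/-- **`T c = c` on constants** for a unital operator linear on bounded continuous functions
(`T 𝟙 = 𝟙`, mass conservation). [cite: BakryGentilLedoux2014, Def. 1.2.1 (i) (p. 10)] -/
theorem markov_map_const
    (hlin : ∀ (h₁ h₂ : M → ℝ) (c : ℝ), Continuous h₁ → (∃ C, ∀ x, |h₁ x| ≤ C) →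
      Continuous h₂ → (∃ C, ∀ x, |h₂ x| ≤ C) →
      T (fun x ↦ c * h₁ x + h₂ x) = fun x ↦ c * T h₁ x + T h₂ x)
    (hone : T (fun _ ↦ (1 : ℝ)) = fun _ ↦ 1) (c : ℝ) : T (fun _ ↦ c) = fun _ ↦ c := by
  have h := hlin (fun _ ↦ (1 : ℝ)) (fun _ ↦ (0 : ℝ)) c continuous_const ⟨1, fun _ ↦ by simp⟩
    continuous_const ⟨0, fun _ ↦ by simp⟩
  have hfun : (fun _ : M ↦ c * (1 : ℝ) + 0) = fun _ ↦ c := funext fun _ ↦ by ring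
  rw [hfun] at h
  funext x
  have hx : T (fun _ ↦ c) x = c * T (fun _ ↦ (1 : ℝ)) x + T (fun _ ↦ (0 : ℝ)) x := congrFun h x
  rw [hone, markov_map_zero hlin] at hx
  simpa using hx

/-- **`T(c h + d) = c T h + d`** for bounded continuous `h` and constants `c, d`.
[cite: BakryGentilLedoux2014, Def. 1.2.1 (p. 10)] -/
theorem markov_apply_affine
    (hlin : ∀ (h₁ h₂ : M → ℝ) (c : ℝ), Continuous h₁ → (∃ C, ∀ x, |h₁ x| ≤ C) →
      Continuous h₂ → (∃ C, ∀ x, |h₂ x| ≤ C) →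
      T (fun x ↦ c * h₁ x + h₂ x) = fun x ↦ c * T h₁ x + T h₂ x)
    (hone : T (fun _ ↦ (1 : ℝ)) = fun _ ↦ 1) {h : M → ℝ} (hc : Continuous h)
    (hb : ∃ C, ∀ x, |h x| ≤ C) (c d : ℝ) (x : M) : T (fun y ↦ c * h y + d) x = c * T h x + d := by
  have hl := hlin h (fun _ ↦ d) c hc hb continuous_const ⟨|d|, fun _ ↦ le_rfl⟩
  have hx : T (fun y ↦ c * h y + d) x = c * T h x + T (fun _ ↦ d) x := congrFun hl x
  rw [markov_map_const hlin hone d] at hx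
  exact hx

/-- **Markov operators preserve order bounds**: `m ≤ h ≤ m'` implies `m ≤ T h ≤ m'` for continuous
`h` (positivity applied to `h − m` and `m' − h`; the contraction property of Bakry–Gentil–Ledoux 2014,
(1.2.2)). [cite: BakryGentilLedoux2014, (1.2.1)–(1.2.2) (pp. 10–11)] -/
theorem markov_apply_mem_Icc
    (hlin : ∀ (h₁ h₂ : M → ℝ) (c : ℝ), Continuous h₁ → (∃ C, ∀ x, |h₁ x| ≤ C) →
      Continuous h₂ → (∃ C, ∀ x, |h₂ x| ≤ C) →
      T (fun x ↦ c * h₁ x + h₂ x) = fun x ↦ c * T h₁ x + T h₂ x)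
    (hpos : ∀ h : M → ℝ, Continuous h → (∃ C, ∀ x, |h x| ≤ C) → (∀ x, 0 ≤ h x) → ∀ x, 0 ≤ T h x)
    (hone : T (fun _ ↦ (1 : ℝ)) = fun _ ↦ 1) {h : M → ℝ} (hc : Continuous h) {m m' : ℝ}
    (hm : ∀ x, m ≤ h x) (hm' : ∀ x, h x ≤ m') (x : M) : m ≤ T h x ∧ T h x ≤ m' := by
  have hb : ∃ C, ∀ x, |h x| ≤ C := ⟨max |m| |m'|, fun x ↦ abs_le_max_abs_abs (hm x) (hm' x)⟩
  have hb' : ∀ (c d : ℝ), ∃ C, ∀ x, |c * h x + d| ≤ C := by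
    intro c d
    refine ⟨|c| * max |m| |m'| + |d|, fun x ↦ (abs_add_le _ _).trans (add_le_add ?_ le_rfl)⟩
    rw [abs_mul]
    exact mul_le_mul_of_nonneg_left (abs_le_max_abs_abs (hm x) (hm' x)) (abs_nonneg _)
  constructor
  · have key := markov_apply_affine hlin hone hc hb 1 (-m) x
    have hp := hpos (fun y ↦ 1 * h y + -m) ((continuous_const.mul hc).add continuous_const)
      (hb' 1 (-m)) (fun y ↦ by linarith [hm y]) x
    linarith
  · have key := markov_apply_affine hlin hone hc hb (-1) m' x
    have hp := hpos (fun y ↦ -1 * h y + m') ((continuous_const.mul hc).add continuous_const)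
      (hb' (-1) m') (fun y ↦ by linarith [hm' y]) x
    linarith

/-- **Cauchy–Schwarz for a Markov operator**: `(T(φψ))² ≤ T(φ²) T(ψ²)` for bounded continuous
`φ, ψ` — positivity of `T((φ − λψ)²)` for every real `λ` and the discriminant (the argument behind
Jensen's inequality `P_t(g²) ≥ (P_t g)²` of Bakry–Gentil–Ledoux 2014, (1.2.2)).
[cite: BakryGentilLedoux2014, (1.2.2) (p. 11)] -/
theorem markov_sq_apply_mul_le
    (hlin : ∀ (h₁ h₂ : M → ℝ) (c : ℝ), Continuous h₁ → (∃ C, ∀ x, |h₁ x| ≤ C) →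
      Continuous h₂ → (∃ C, ∀ x, |h₂ x| ≤ C) →
      T (fun x ↦ c * h₁ x + h₂ x) = fun x ↦ c * T h₁ x + T h₂ x)
    (hpos : ∀ h : M → ℝ, Continuous h → (∃ C, ∀ x, |h x| ≤ C) → (∀ x, 0 ≤ h x) → ∀ x, 0 ≤ T h x)
    {φ ψ : M → ℝ} (hφ : Continuous φ) (hφb : ∃ C, ∀ x, |φ x| ≤ C) (hψ : Continuous ψ)
    (hψb : ∃ C, ∀ x, |ψ x| ≤ C) (x : M) :
    (T (fun y ↦ φ y * ψ y) x) ^ 2 ≤ T (fun y ↦ φ y ^ 2) x * T (fun y ↦ ψ y ^ 2) x := by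
  obtain ⟨Cφ, hCφ⟩ := hφb
  obtain ⟨Cψ, hCψ⟩ := hψb
  have hCφ0 : 0 ≤ Cφ := (abs_nonneg _).trans (hCφ x)
  -- the three functions and their bounds
  have hAc : Continuous (fun y ↦ φ y ^ 2) := hφ.pow 2
  have hBc : Continuous (fun y ↦ φ y * ψ y) := hφ.mul hψ
  have hCc : Continuous (fun y ↦ ψ y ^ 2) := hψ.pow 2
  have hφ2 : ∀ y, |φ y ^ 2| ≤ Cφ ^ 2 := fun y ↦ by
    rw [abs_pow]; exact pow_le_pow_left₀ (abs_nonneg _) (hCφ y) 2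
  have hψ2 : ∀ y, |ψ y ^ 2| ≤ Cψ ^ 2 := fun y ↦ by
    rw [abs_pow]; exact pow_le_pow_left₀ (abs_nonneg _) (hCψ y) 2
  have hφψ : ∀ y, |φ y * ψ y| ≤ Cφ * Cψ := fun y ↦ by
    rw [abs_mul]; exact mul_le_mul (hCφ y) (hCψ y) (abs_nonneg _) hCφ0
  -- `0 ≤ T((φ − lψ)²) = T(ψ²) l² − 2 l T(φψ) + T(φ²)`
  have hquad : ∀ l : ℝ, 0 ≤ T (fun y ↦ ψ y ^ 2) x * (l * l) + (-2 * T (fun y ↦ φ y * ψ y) x) * l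
      + T (fun y ↦ φ y ^ 2) x := by
    intro l
    have hb2 : ∀ y, |l ^ 2 * ψ y ^ 2 + φ y ^ 2| ≤ l ^ 2 * Cψ ^ 2 + Cφ ^ 2 := fun y ↦ by
      refine (abs_add_le _ _).trans (add_le_add ?_ (hφ2 y))
      rw [abs_mul, abs_pow, sq_abs]
      exact mul_le_mul_of_nonneg_left (hψ2 y) (sq_nonneg _)
    have hl1 := hlin (fun y ↦ ψ y ^ 2) (fun y ↦ φ y ^ 2) (l ^ 2) hCc ⟨_, hψ2⟩ hAc ⟨_, hφ2⟩
    have hl2 := hlin (fun y ↦ φ y * ψ y) (fun y ↦ l ^ 2 * ψ y ^ 2 + φ y ^ 2) (-2 * l) hBc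
      ⟨_, hφψ⟩ ((continuous_const.mul hCc).add hAc) ⟨_, hb2⟩
    have hx1 : T (fun y ↦ l ^ 2 * ψ y ^ 2 + φ y ^ 2) x =
        l ^ 2 * T (fun y ↦ ψ y ^ 2) x + T (fun y ↦ φ y ^ 2) x := congrFun hl1 x
    have hx2 : T (fun y ↦ -2 * l * (φ y * ψ y) + (l ^ 2 * ψ y ^ 2 + φ y ^ 2)) x =
        -2 * l * T (fun y ↦ φ y * ψ y) x + T (fun y ↦ l ^ 2 * ψ y ^ 2 + φ y ^ 2) x :=
      congrFun hl2 x
    have hfun : (fun y ↦ (φ y - l * ψ y) ^ 2) =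
        fun y ↦ -2 * l * (φ y * ψ y) + (l ^ 2 * ψ y ^ 2 + φ y ^ 2) := by
      funext y; ring
    have hbd : ∀ y, |(φ y - l * ψ y) ^ 2| ≤ (Cφ + |l| * Cψ) ^ 2 := fun y ↦ by
      rw [abs_pow]
      refine pow_le_pow_left₀ (abs_nonneg _) ?_ 2
      refine (abs_sub _ _).trans (add_le_add (hCφ y) ?_)
      rw [abs_mul]
      exact mul_le_mul_of_nonneg_left (hCψ y) (abs_nonneg _)
    have hp := hpos (fun y ↦ (φ y - l * ψ y) ^ 2) ((hφ.sub (continuous_const.mul hψ)).pow 2)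
      ⟨_, hbd⟩ (fun y ↦ sq_nonneg _) x
    rw [hfun] at hp
    rw [hx2, hx1] at hp
    nlinarith [hp]
  have hdisc := discrim_le_zero hquad
  rw [discrim] at hdisc
  nlinarith [hdisc]

end Literature.Geometry.Riemannian

end
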